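import Summits.QuantumFields.YangMills.Theorems.BalabanUVNodesN20CoreEdgeAtShellSplitOfRecordOneSided

/-!
# BalabanUVNodes ∕ N20 (NE7b) — the `hedge`-JOINT COMPANION, module 11: N19's core edge of the spine reading of record AT THE SHELL SPLIT OF RECORD,
# FLOW-FREE — no `RAgree`, no `0 < θ.τ9.M`, every policy: «(i) the term core of each run-A history against the term cores of its FLOW-FREE block-down fibre,
# summed; (ii) one-sided run-B classes carry zero fibre core» — loss-free; lowered-threshold form; the transfers ON THE LIVE-SELECTOR LINE with the weakest
# hypothesis list of this seat's lineage

Cell `pub-ymgap` (HUMAN RULING D-0062 Track A; D-0149 width push), seat `pub-ymgap-dag-n20-w3` (WIDTH SEAT 3 of 3 on NODE n20 = NE7b) gen 2, INTENT-11 (pub-ymgap INBOX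
l.27380).  Modules 7–9 read the core edge under node U5d's flow hypothesis `hR : RAgree` (option (c): run B's keys block down INTO run A's index type via
`truncSeq`); module 10 recorded what the edge forces on ONE-SIDED classes when `hR` is dropped.  dag-n20-d's key of record `keyB₁₃` IS flow-free (option (b),
`seqKey ∘ truncShift`, `Node00/TwoRunSiteKey`; n20-w2's `…GoodFibreFlowFree` reads N20's face that way), so the loss-free statement needs no flow hypothesis either:
module 1's abstract iff `core_keyed_iff_termwise` minus its partner hypothesis `range kB ⊆ range kA`, with the one-sided run-B classes as a second conjunct.  Filed
`--kind proof --supports stmt-QuantumFields-20544 --as helper` (K3⁷ `SpineGivenEndpointR13SepCoPH`); COUNT-NEUTRAL.  [III] = [Balaban1988Convergent], [LF-I∕II] =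
[Balaban1989LargeFieldI∕II].

WHAT IS PROVED (bookkeeping; the record instance is `rfl` over the reading's objects plus module 7's `shellA₁₃_keyA` and module 10's `shellA₁₃_eq_zero_of_not_mem_image`).
* §1 ★ `core_keyed_iff_termwise_oneSided` (abstract: `kA` injective, `kB` ARBITRARY, any `Bad`, shells with `shA = 0` off run A's key image): `NE7.Core` on the keyed
  two-source fibre cores IFF for every `K` ONE `c` with, for all `|t| ≤ l₀`, (i) the termwise sandwich on every run-A term whose key is off `Bad` (run B's fibre over it
  summed — possibly EMPTY, which then forces the run-A term core to vanish) AND (ii) ZERO fibre core on every good run-B key outside run A's key image.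
* §2 ★★★ `core_shellSplit₁₃_iff_flowFree`: AT THE RECORD with dag-n21-d's `shellSplitOfRecord₁₃At N K₀ ρA ρB`, EVERY policy `jcut`, `(l₀, vol, δ)` generic — the
  hypothesis `h` of dag-n20-d's transfers IFF (i) `e^{c ∓ vol·δ K}`-sandwich of `cw_A(s) − σ_A(s)` against `Σ_{s' : keyB₁₃ s' = keyA₁₃ s} (cw_B(s') − σ_B(s'))` for every run-A
  index `s` off the persistence class ∧ (ii) `Σ_{s'' : keyB₁₃ s'' = keyB₁₃ s'} (cw_B − σ_B) = 0` for every good run-B key carried by no run-A index.  Under `RAgree` (ii) is void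
  (dag-n20-d's section, n19-d §4) and (i)'s fibre is the `truncSeq`-fibre (module 9) ∕ `{liftSeq s}` on the good class of a policy `≥ 1` (module 7).
* §3 ★★ `core_shellSplit₁₃_iff_loweredFlowFree`: under (H-U), `0 ≤ ε·ρ` per run and F3's (e1) integrability, the same with every term core READ AS the (2.18) term
  re-tested at `ε_k(1 − ρ)` (dag-n21-d §3b).  ★★★ `core_crOfRecord₁₃At_shellSplit_of_loweredFlowFree_liveSel` ∕ `core_crOfRecord₁₃VAt_shellSplit_of_loweredFlowFree_liveSel`:
  ON THE LIVE-SELECTOR LINE the N19′ conjunct `NE7.Core … ∧ Summable …` AT `crOfRecord₁₃(V)At K₀ jcut (shellSplitOfRecord₁₃At …)` follows from the lowered flow-free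
  pair + `Summable δ` + (H-U) + (H-ζ) + the widths' sign — NOTHING ELSE (no flow hypothesis, no cube-size letter, no policy letter; sign letter by module 7, (e1) by
  dag-n21-d `integrable_topPieceA∕B_of_liveSel` p593341, `0 ≤ ζ` by n20-w2 p593923).  This is the weakest-hypothesis producer interface for K3⁷ v3's N19′ slot at the
  witness `(jc, shellSplitOfRecord₁₃At …)` in this lineage (dag-n27-c's storeys cite module 8's; either serves).

(α) READING ∕ LOCATED banner as in modules 2∕4∕5∕7∕10 (NC-NE7b-α UNRULED; policy and widths are the prover's dials, plan g81 rulings (a)).  Conjunct (ii) and the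
empty-fibre case of (i) are exactly module 10's one-sided sentences (jump window of (2.5)'s `RkOfRecord`): a stub-2 prover not supplying the flow agreement pays for
one-sided histories through the policy or shows their lowered small-field events dressed-null.

HONEST FRAMING.  Count-neutral bookkeeping; nothing re-typed.  NO estimate is proved: the flow-free pair IS N19's NE7 core at the record — NOT PRINTED for `d = 4` ([LF-II]
p.356), NOT proved, NAMED OPEN; §1–§3's iffs are LOCATED, the transfers carry the pair as HYPOTHESIS (inhabited by no Bałaban family today — A2 declared; non-vacuous
as statements — A6).  NE7 ∕ NE7b ∕ NE7c NOT PRINTED ∕ NOT PROVED; (α)-instance 0∕1; N19 ∕ N20 ∕ N21 NOT discharged; K3⁷ NOT closed; counts unmoved (typed 28∕28 · discharged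
5∕27); no count claim.  One finite `𝕋⁴_{L^K}` programme at fixed `ε = L^{−K}` along two consecutive cutoffs, Bałaban AS PRINTED; the YM mass gap (Clay) is NOT proved by any of
this — R4 closes the conditional finite-𝕋⁴ rung `BalabanLadder.UV` only; NOT ℝ⁴, NOT OS.  No `instance`, no `notation`, no `def`, no `sorry`, no private decls.  Sources
(bookkeeping): [III] (2.1) p.254, (2.5) p.255, (2.17)–(2.18) p.257; [LF-I] (0.2)–(0.4) p.176, p.193; [LF-II] Thm 1 + (0.1) pp.355–356, (1.80) p.384; [King1986] (3.10) p.656.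
-/

noncomputable section

namespace Summit.QuantumFields.YangMills.BalabanUVNodes.N20CoreEdgeAtShellSplitFlowFree

open Literature.MathematicalPhysics.QuantumFieldTheory.Balaban1983to89 Literature.MathematicalPhysics.QuantumFieldTheory.Balaban1983to89.T4Continuum
open Literature.MathematicalPhysics.QuantumFieldTheory.Balaban1983to89.Node00
open scoped BigOperators
open MeasureTheory
open B14.Eq218Concrete Summit.QuantumFields.BalabanUV.T4Continuum.Spine
open YMDAG.UVSplit (crOfRecord₁₃At crOfRecord₁₃VAt crOfRecord₁₃ ShellSplit₁₃CoPH keyA₁₃ keyB₁₃ keyB₁₃_eq runA₁₃ runB₁₃ histA₁₃ histB₁₃ classSet₁₃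
  weightA₁₃ weightB₁₃ badClass₁₃)
open Summit.QuantumFields.YangMills.Theorems.N21ShellSplitOfRecord13CoPH
open Summit.QuantumFields.YangMills.BalabanUVNodes.N20CoreEdgeAtShellSplit
open Summit.QuantumFields.YangMills.BalabanUVNodes.N20CoreEdgeAtShellSplitOneSided
open Summit.QuantumFields.YangMills.BalabanUVNodes.N20CoreEdgeAtReading13 (core_decidableEq_irrel)
open Summit.QuantumFields.YangMills.BalabanUVNodes.N20CoreEdgeTwoRunKeyed (sum_filter_key_eq_of_injective)
open Summit.QuantumFields.YangMills.BalabanUVNodes.N19TargetClassWeightsTwoRunKeyed (sigma_twoRunKeyA_injective)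
open Summit.QuantumFields.YangMills.BalabanUVNodes.N19TargetKeyedUnpartnered (sum_filter_key_eq_zero_of_not_mem_image)

/-! ## §1 Abstract: `NE7.Core` on keyed two-source fibre sums WITHOUT the partner hypothesis `range kB ⊆ range kA` -/

section Abstract

variable {κ : Type*} [DecidableEq κ] {σA σB : ℕ → Type*} [∀ K, Fintype (σA K)] [∀ K, Fintype (σB K)]

/-- **★ `NE7.Core` ON KEYED TWO-SOURCE FIBRE SUMS, NO PARTNER HYPOTHESIS — LOSS-FREE.**  Module 1's `core_keyed_iff_termwise` assumed `range (kB K) ⊆ range (kA K)`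
(every run-B class has a run-A partner — node U5d's flow hypothesis).  Without it, provided run A's shell reading vanishes off run A's key image (true for any kA-fibre
sum), `NE7.Core` on the keyed cores IFF for every `K` ONE `c` with, for all `|t| ≤ l₀`: (i) the termwise sandwich on every run-A term whose key is not bad (run B's
fibre over that key summed — possibly EMPTY, which then forces run A's term core to vanish), AND (ii) every run-B key that is good and OUTSIDE run A's key image
carries ZERO fibre core. [cite: King1986, (3.10) p.656; Balaban1988Convergent, (2.5) p.255, (2.18) p.257 (bookkeeping)] -/
theorem core_keyed_iff_termwise_oneSided {l₀ vol : ℝ} (kA : (K : ℕ) → σA K → κ) (kB : (K : ℕ) → σB K → κ)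
    (hinj : ∀ K, Function.Injective (kA K))
    (a : (K : ℕ) → ℝ → σA K → ℝ) (b : (K : ℕ) → ℝ → σB K → ℝ) (shA shB : ℕ → ℝ → κ → ℝ)
    (hshA : ∀ (K : ℕ) (t : ℝ) (x : κ), x ∉ Finset.univ.image (kA K) → shA K t x = 0)
    (Bad : ℕ → ℝ → Finset κ) (δ : ℕ → ℝ) :
    NE7.Core l₀ vol (fun K => Finset.univ.image (kA K) ∪ Finset.univ.image (kB K)) Bad
        (fun K t x => (∑ s ∈ Finset.univ.filter (fun s => kA K s = x), a K t s) - shA K t x)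
        (fun K t x => (∑ s' ∈ Finset.univ.filter (fun s' => kB K s' = x), b K t s') - shB K t x) δ
      ↔ ∀ K : ℕ, ∃ c : ℝ, ∀ t : ℝ, |t| ≤ l₀ →
          (∀ s : σA K, kA K s ∉ Bad K t →
            Real.exp (c - vol * δ K) * (a K t s - shA K t (kA K s))
                ≤ (∑ s' ∈ Finset.univ.filter (fun s' => kB K s' = kA K s), b K t s') - shB K t (kA K s) ∧
              (∑ s' ∈ Finset.univ.filter (fun s' => kB K s' = kA K s), b K t s') - shB K t (kA K s)
                ≤ Real.exp (c + vol * δ K) * (a K t s - shA K t (kA K s))) ∧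
          (∀ s' : σB K, kB K s' ∉ Finset.univ.image (kA K) → kB K s' ∉ Bad K t →
            (∑ s'' ∈ Finset.univ.filter (fun s'' => kB K s'' = kB K s'), b K t s'') - shB K t (kB K s') = 0) := by
  constructor
  · intro h K
    obtain ⟨c, hc⟩ := h K
    refine ⟨c, fun t ht => ⟨fun s hs => ?_, fun s' hunp hs' => ?_⟩⟩
    · have hmem : kA K s ∈ (Finset.univ.image (kA K) ∪ Finset.univ.image (kB K)) \ Bad K t :=
        Finset.mem_sdiff.mpr ⟨Finset.mem_union_left _ (Finset.mem_image_of_mem _ (Finset.mem_univ s)), hs⟩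
      have h' := hc t ht (kA K s) hmem
      simp only [sum_filter_key_eq_of_injective hinj K (a K t) s] at h'
      exact h'
    · have hmem : kB K s' ∈ (Finset.univ.image (kA K) ∪ Finset.univ.image (kB K)) \ Bad K t :=
        Finset.mem_sdiff.mpr ⟨Finset.mem_union_right _ (Finset.mem_image_of_mem _ (Finset.mem_univ s')), hs'⟩
      have h' := hc t ht (kB K s') hmem
      simp only [sum_filter_key_eq_zero_of_not_mem_image (kA K) (a K t) hunp, hshA K t _ hunp, sub_zero, mul_zero] at h'
      exact le_antisymm h'.2 h'.1
  · intro h K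
    obtain ⟨c, hc⟩ := h K
    refine ⟨c, fun t ht x hx => ?_⟩
    obtain ⟨hxT, hxB⟩ := Finset.mem_sdiff.mp hx
    by_cases hxA : x ∈ Finset.univ.image (kA K)
    · obtain ⟨s, -, rfl⟩ := Finset.mem_image.mp hxA
      have h' := (hc t ht).1 s hxB
      simp only [sum_filter_key_eq_of_injective hinj K (a K t) s]
      exact h'
    · have hxB' : x ∈ Finset.univ.image (kB K) := by
        rcases Finset.mem_union.mp hxT with h1 | h2
        · exact (hxA h1).elim
        · exact h2
      obtain ⟨s', -, rfl⟩ := Finset.mem_image.mp hxB'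
      have h' := (hc t ht).2 s' hxA hxB
      simp only [sum_filter_key_eq_zero_of_not_mem_image (kA K) (a K t) hxA, hshA K t _ hxA, sub_zero, mul_zero, h']
      exact ⟨le_rfl, le_rfl⟩

end Abstract

/-! ## §2 At the reading of record with the shell split of record: N19's core edge FLOW-FREE — no `RAgree`, no `0 < θ.τ9.M`, every policy -/

section Record

variable {F : T4Family} {N : ℕ} [NeZero N]
variable (θ : Stage13HParams F N) (hP : θ.Provisos₁₃CoPH F N) (K₀ : ℕ) (g₀ : ℕ → ℝ) (os : List (ULoop F))

/-- **★★★ N19's CORE EDGE AT THE SHELL SPLIT OF RECORD, FLOW-FREE — LOSS-FREE.**  NO flow hypothesis `RAgree`, NO `0 < θ.τ9.M`, EVERY policy `jcut`, all widths,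
`(l₀, vol, δ)` generic: `NE7.Core l₀ vol (classSet₁₃ …) (badClass₁₃ … jcut) (weightA₁₃ − shellA₁₃ ρA) (weightB₁₃ − shellB₁₃ ρB) δ` (the hypothesis `h` of dag-n20-d's
`core_crOfRecord₁₃At ∕ …VAt` at `sh := shellSplitOfRecord₁₃At N K₀ ρA ρB`) IFF for every `K` ONE `c` with, for all `|t| ≤ l₀`:
(i) for every run-A (2.18) index `s` whose key of record is off the persistence class, `e^{c − vol·δ K}·(cw_A(s) − σ_A(s)) ≤ Σ_{s' : keyB₁₃ s' = keyA₁₃ s} (cw_B(s') − σ_B(s'))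
≤ e^{c + vol·δ K}·(cw_A(s) − σ_A(s))` — run B's fibre over `s` is indexed by dag-n20-d's FLOW-FREE key of record `keyB₁₃` (option (b): `seqKey ∘ truncShift`), possibly EMPTY
(then the sandwich says `cw_A(s) = σ_A(s)`, module 10); AND (ii) every run-B index `s'` whose key is good and carried by NO run-A index has ZERO fibre core
`Σ_{s'' : keyB₁₃ s'' = keyB₁₃ s'} (cw_B(s'') − σ_B(s'')) = 0`.  Under `RAgree` (ii) is void and (i)'s fibre is the `truncSeq`-fibre (module 9) ∕ `{liftSeq s}` on the good
class (module 7).  The right-hand side is N19's NE7 core at the record — NOT PRINTED, NOT proved.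
[cite: King1986, (3.10) p.656; Balaban1989LargeFieldII, Thm 1 + (0.1) pp.355–356, (1.80) p.384; Balaban1988Convergent, (2.5) p.255, (2.18) p.257; Balaban1989LargeFieldI, (0.2)–(0.4) p.176, p.193 (bookkeeping)] -/
theorem core_shellSplit₁₃_iff_flowFree (jcut : ℕ → ℕ) (ρA ρB : ℕ → ℝ) (l₀ vol : ℝ) (δ : ℕ → ℝ) :
    (letI : DecidableEq (Σ K, SiteSeqKey F (K₀ + K)) := Classical.decEq _
     NE7.Core l₀ vol (classSet₁₃ θ K₀ g₀) (badClass₁₃ θ K₀ g₀ jcut)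
       (fun K t x => weightA₁₃ θ hP K₀ g₀ os K t x - shellA₁₃ θ hP K₀ g₀ os ρA K t x)
       (fun K t x => weightB₁₃ θ hP K₀ g₀ os K t x - shellB₁₃ θ hP K₀ g₀ os ρB K t x) δ)
      ↔ (letI : ∀ Kc, DecidableEq (SiteSeqKey F Kc) := fun _ => Classical.decEq _
         ∀ K : ℕ, ∃ c : ℝ, ∀ t : ℝ, |t| ≤ l₀ →
          (∀ s : SeqOfRecord F θ.ν θ.τ9.M (histA₁₃ θ K₀ g₀ K) (K₀ + K) (K₀ + K), keyA₁₃ θ K₀ g₀ K s ∉ badClass₁₃ θ K₀ g₀ jcut K t →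
            Real.exp (c - vol * δ K) * (classWeightOfDatum₉ F N θ.toStage9Params (datumOfRecord₁₃CoPH F N θ hP) g₀ os (runA₁₃ F K₀ g₀ K) (histA₁₃ θ K₀ g₀ K) (K₀ + K) t s
                - shellWeightOfDatum₉ F N θ.toStage9Params (datumOfRecord₁₃CoPH F N θ hP) g₀ os (runA₁₃ F K₀ g₀ K) (histA₁₃ θ K₀ g₀ K) (K₀ + K) (ρA K) t s)
              ≤ ∑ s' ∈ Finset.univ.filter (fun s' : SeqOfRecord F θ.ν θ.τ9.M (histB₁₃ θ K₀ g₀ K) (K₀ + K + 1) (K₀ + K + 1) => keyB₁₃ θ K₀ g₀ K s' = keyA₁₃ θ K₀ g₀ K s),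
                  (classWeightOfDatum₉ F N θ.toStage9Params (datumOfRecord₁₃CoPH F N θ hP) g₀ os (runB₁₃ F K₀ g₀ K) (histB₁₃ θ K₀ g₀ K) (K₀ + K + 1) t s'
                    - shellWeightOfDatum₉ F N θ.toStage9Params (datumOfRecord₁₃CoPH F N θ hP) g₀ os (runB₁₃ F K₀ g₀ K) (histB₁₃ θ K₀ g₀ K) (K₀ + K + 1) (ρB K) t s') ∧
            ∑ s' ∈ Finset.univ.filter (fun s' : SeqOfRecord F θ.ν θ.τ9.M (histB₁₃ θ K₀ g₀ K) (K₀ + K + 1) (K₀ + K + 1) => keyB₁₃ θ K₀ g₀ K s' = keyA₁₃ θ K₀ g₀ K s),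
                  (classWeightOfDatum₉ F N θ.toStage9Params (datumOfRecord₁₃CoPH F N θ hP) g₀ os (runB₁₃ F K₀ g₀ K) (histB₁₃ θ K₀ g₀ K) (K₀ + K + 1) t s'
                    - shellWeightOfDatum₉ F N θ.toStage9Params (datumOfRecord₁₃CoPH F N θ hP) g₀ os (runB₁₃ F K₀ g₀ K) (histB₁₃ θ K₀ g₀ K) (K₀ + K + 1) (ρB K) t s')
              ≤ Real.exp (c + vol * δ K) * (classWeightOfDatum₉ F N θ.toStage9Params (datumOfRecord₁₃CoPH F N θ hP) g₀ os (runA₁₃ F K₀ g₀ K) (histA₁₃ θ K₀ g₀ K) (K₀ + K) t s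
                - shellWeightOfDatum₉ F N θ.toStage9Params (datumOfRecord₁₃CoPH F N θ hP) g₀ os (runA₁₃ F K₀ g₀ K) (histA₁₃ θ K₀ g₀ K) (K₀ + K) (ρA K) t s)) ∧
          (∀ s' : SeqOfRecord F θ.ν θ.τ9.M (histB₁₃ θ K₀ g₀ K) (K₀ + K + 1) (K₀ + K + 1), keyB₁₃ θ K₀ g₀ K s' ∉ Finset.univ.image (keyA₁₃ θ K₀ g₀ K) →
            keyB₁₃ θ K₀ g₀ K s' ∉ badClass₁₃ θ K₀ g₀ jcut K t →
            ∑ s'' ∈ Finset.univ.filter (fun s'' : SeqOfRecord F θ.ν θ.τ9.M (histB₁₃ θ K₀ g₀ K) (K₀ + K + 1) (K₀ + K + 1) => keyB₁₃ θ K₀ g₀ K s'' = keyB₁₃ θ K₀ g₀ K s'),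
                (classWeightOfDatum₉ F N θ.toStage9Params (datumOfRecord₁₃CoPH F N θ hP) g₀ os (runB₁₃ F K₀ g₀ K) (histB₁₃ θ K₀ g₀ K) (K₀ + K + 1) t s''
                  - shellWeightOfDatum₉ F N θ.toStage9Params (datumOfRecord₁₃CoPH F N θ hP) g₀ os (runB₁₃ F K₀ g₀ K) (histB₁₃ θ K₀ g₀ K) (K₀ + K + 1) (ρB K) t s'') = 0)) := by
  letI : ∀ Kc, DecidableEq (SiteSeqKey F Kc) := fun _ => Classical.decEq _
  have key := core_keyed_iff_termwise_oneSided (l₀ := l₀) (vol := vol) (fun K => keyA₁₃ θ K₀ g₀ K) (fun K => keyB₁₃ θ K₀ g₀ K)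
    (fun K => sigma_twoRunKeyA_injective F θ.ν K₀ θ.τ9.M (fun K => histA₁₃ θ K₀ g₀ K) K)
    (fun K t s => classWeightOfDatum₉ F N θ.toStage9Params (datumOfRecord₁₃CoPH F N θ hP) g₀ os (runA₁₃ F K₀ g₀ K) (histA₁₃ θ K₀ g₀ K) (K₀ + K) t s)
    (fun K t s' => classWeightOfDatum₉ F N θ.toStage9Params (datumOfRecord₁₃CoPH F N θ hP) g₀ os (runB₁₃ F K₀ g₀ K) (histB₁₃ θ K₀ g₀ K) (K₀ + K + 1) t s')
    (shellA₁₃ θ hP K₀ g₀ os ρA) (shellB₁₃ θ hP K₀ g₀ os ρB)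
    (fun K t x hx => shellA₁₃_eq_zero_of_not_mem_image θ hP K₀ g₀ os ρA K t hx) (badClass₁₃ θ K₀ g₀ jcut) δ
  have hT : classSet₁₃ θ K₀ g₀ = fun K => Finset.univ.image (keyA₁₃ θ K₀ g₀ K) ∪ Finset.univ.image (keyB₁₃ θ K₀ g₀ K) := rfl
  have hA : (fun K t x => weightA₁₃ θ hP K₀ g₀ os K t x - shellA₁₃ θ hP K₀ g₀ os ρA K t x) = fun K t x =>
      (∑ s ∈ Finset.univ.filter (fun s : SeqOfRecord F θ.ν θ.τ9.M (histA₁₃ θ K₀ g₀ K) (K₀ + K) (K₀ + K) => keyA₁₃ θ K₀ g₀ K s = x), classWeightOfDatum₉ F N θ.toStage9Params (datumOfRecord₁₃CoPH F N θ hP) g₀ os (runA₁₃ F K₀ g₀ K) (histA₁₃ θ K₀ g₀ K) (K₀ + K) t s) - shellA₁₃ θ hP K₀ g₀ os ρA K t x := rfl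
  have hB : (fun K t x => weightB₁₃ θ hP K₀ g₀ os K t x - shellB₁₃ θ hP K₀ g₀ os ρB K t x) = fun K t x =>
      (∑ s' ∈ Finset.univ.filter (fun s' : SeqOfRecord F θ.ν θ.τ9.M (histB₁₃ θ K₀ g₀ K) (K₀ + K + 1) (K₀ + K + 1) => keyB₁₃ θ K₀ g₀ K s' = x), classWeightOfDatum₉ F N θ.toStage9Params (datumOfRecord₁₃CoPH F N θ hP) g₀ os (runB₁₃ F K₀ g₀ K) (histB₁₃ θ K₀ g₀ K) (K₀ + K + 1) t s') - shellB₁₃ θ hP K₀ g₀ os ρB K t x := rfl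
  rw [hA, hB, hT]
  refine (core_decidableEq_irrel _ _).trans (key.trans ?_)
  refine forall_congr' fun K => exists_congr fun c => forall_congr' fun t => forall_congr' fun _ => and_congr ?_ ?_
  · refine forall_congr' fun s => forall_congr' fun _ => ?_
    have hshA : shellA₁₃ θ hP K₀ g₀ os ρA K t (keyA₁₃ θ K₀ g₀ K s) = shellWeightOfDatum₉ F N θ.toStage9Params (datumOfRecord₁₃CoPH F N θ hP) g₀ os (runA₁₃ F K₀ g₀ K) (histA₁₃ θ K₀ g₀ K) (K₀ + K) (ρA K) t s :=
      shellA₁₃_keyA θ hP K₀ g₀ os ρA K t s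
    have hshB : shellB₁₃ θ hP K₀ g₀ os ρB K t (keyA₁₃ θ K₀ g₀ K s) =
        ∑ s' ∈ Finset.univ.filter (fun s' : SeqOfRecord F θ.ν θ.τ9.M (histB₁₃ θ K₀ g₀ K) (K₀ + K + 1) (K₀ + K + 1) => keyB₁₃ θ K₀ g₀ K s' = keyA₁₃ θ K₀ g₀ K s), shellWeightOfDatum₉ F N θ.toStage9Params (datumOfRecord₁₃CoPH F N θ hP) g₀ os (runB₁₃ F K₀ g₀ K) (histB₁₃ θ K₀ g₀ K) (K₀ + K + 1) (ρB K) t s' := rfl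
    rw [hshA, hshB, ← Finset.sum_sub_distrib]
  · refine forall_congr' fun s' => forall_congr' fun _ => forall_congr' fun _ => ?_
    have hshB : shellB₁₃ θ hP K₀ g₀ os ρB K t (keyB₁₃ θ K₀ g₀ K s') =
        ∑ s'' ∈ Finset.univ.filter (fun s'' : SeqOfRecord F θ.ν θ.τ9.M (histB₁₃ θ K₀ g₀ K) (K₀ + K + 1) (K₀ + K + 1) => keyB₁₃ θ K₀ g₀ K s'' = keyB₁₃ θ K₀ g₀ K s'), shellWeightOfDatum₉ F N θ.toStage9Params (datumOfRecord₁₃CoPH F N θ hP) g₀ os (runB₁₃ F K₀ g₀ K) (histB₁₃ θ K₀ g₀ K) (K₀ + K + 1) (ρB K) t s'' := rfl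
    rw [hshB, ← Finset.sum_sub_distrib]

end Record

/-! ## §3 The same with the term cores READ AT THE LOWERED THRESHOLD, and the transfers ON THE LIVE-SELECTOR LINE — still flow-free -/

section Lowered

variable {F : T4Family} {N : ℕ} [NeZero N]
variable (θ : Stage13HParams F N) (hP : θ.Provisos₁₃CoPH F N) (K₀ : ℕ) (g₀ : ℕ → ℝ) (os : List (ULoop F))

/-- **★★ THE FLOW-FREE CORE EDGE WITH LOWERED-THRESHOLD TERMS** (dag-n21-d §3b inside both conjuncts; (H-U), `0 ≤ ε·ρ` per run and F3's (e1) integrability of both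
runs' top pieces displayed). [cite: King1986, (3.10) p.656; Balaban1989LargeFieldII, Thm 1 + (0.1) pp.355–356, (1.80) p.384; Balaban1988Convergent, (2.5) p.255, (2.17)–(2.18) p.257; Balaban1989LargeFieldI, p.193 (bookkeeping)] -/
theorem core_shellSplit₁₃_iff_loweredFlowFree (jcut : ℕ → ℕ) (ρA ρB : ℕ → ℝ) (l₀ vol : ℝ) (δ : ℕ → ℝ)
    (hU : LocalBgMeasurable F N θ.ν)
    (hρA : ∀ K, 0 ≤ epsOfRecord θ.ν (histA₁₃ θ K₀ g₀ K) (K₀ + K) * ρA K)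
    (hρB : ∀ K, 0 ≤ epsOfRecord θ.ν (histB₁₃ θ K₀ g₀ K) (K₀ + K + 1) * ρB K)
    (hintA : ∀ (K : ℕ) (t : ℝ) (s : SeqOfRecord F θ.ν θ.τ9.M (histA₁₃ θ K₀ g₀ K) (K₀ + K) (K₀ + K)),
      Integrable (fun V => chiSeqOfRecord F N θ.ν θ.τ9.M (histA₁₃ θ K₀ g₀ K) (K₀ + K) (K₀ + K) s V *
        dressedSlotsOfDatum₉ F N θ.toStage9Params (datumOfRecord₁₃CoPH F N θ hP) g₀ os t (runA₁₃ F K₀ g₀ K) (histA₁₃ θ K₀ g₀ K) (K₀ + K) s V)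
        (fieldMeasure (F.P (K₀ + K)) (K₀ + K) (Node00.SU N)))
    (hintB : ∀ (K : ℕ) (t : ℝ) (s' : SeqOfRecord F θ.ν θ.τ9.M (histB₁₃ θ K₀ g₀ K) (K₀ + K + 1) (K₀ + K + 1)),
      Integrable (fun V => chiSeqOfRecord F N θ.ν θ.τ9.M (histB₁₃ θ K₀ g₀ K) (K₀ + K + 1) (K₀ + K + 1) s' V *
        dressedSlotsOfDatum₉ F N θ.toStage9Params (datumOfRecord₁₃CoPH F N θ hP) g₀ os t (runB₁₃ F K₀ g₀ K) (histB₁₃ θ K₀ g₀ K) (K₀ + K + 1) s' V)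
        (fieldMeasure (F.P (K₀ + K + 1)) (K₀ + K + 1) (Node00.SU N))) :
    (letI : DecidableEq (Σ K, SiteSeqKey F (K₀ + K)) := Classical.decEq _
     NE7.Core l₀ vol (classSet₁₃ θ K₀ g₀) (badClass₁₃ θ K₀ g₀ jcut)
       (fun K t x => weightA₁₃ θ hP K₀ g₀ os K t x - shellA₁₃ θ hP K₀ g₀ os ρA K t x)
       (fun K t x => weightB₁₃ θ hP K₀ g₀ os K t x - shellB₁₃ θ hP K₀ g₀ os ρB K t x) δ)
      ↔ (letI : ∀ Kc, DecidableEq (SiteSeqKey F Kc) := fun _ => Classical.decEq _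
         ∀ K : ℕ, ∃ c : ℝ, ∀ t : ℝ, |t| ≤ l₀ →
          (∀ s : SeqOfRecord F θ.ν θ.τ9.M (histA₁₃ θ K₀ g₀ K) (K₀ + K) (K₀ + K), keyA₁₃ θ K₀ g₀ K s ∉ badClass₁₃ θ K₀ g₀ jcut K t →
            Real.exp (c - vol * δ K) * (∫ V, chiSeqOfRecordAt F N θ.ν θ.τ9.M (histA₁₃ θ K₀ g₀ K) (K₀ + K) (K₀ + K)
                    (epsOfRecord θ.ν (histA₁₃ θ K₀ g₀ K) (K₀ + K) * (1 - ρA K)) s V *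
                  dressedSlotsOfDatum₉ F N θ.toStage9Params (datumOfRecord₁₃CoPH F N θ hP) g₀ os t (runA₁₃ F K₀ g₀ K) (histA₁₃ θ K₀ g₀ K) (K₀ + K) s V
                  ∂fieldMeasure (F.P (K₀ + K)) (K₀ + K) (Node00.SU N))
              ≤ ∑ s' ∈ Finset.univ.filter (fun s' : SeqOfRecord F θ.ν θ.τ9.M (histB₁₃ θ K₀ g₀ K) (K₀ + K + 1) (K₀ + K + 1) => keyB₁₃ θ K₀ g₀ K s' = keyA₁₃ θ K₀ g₀ K s),
                  (∫ V, chiSeqOfRecordAt F N θ.ν θ.τ9.M (histB₁₃ θ K₀ g₀ K) (K₀ + K + 1) (K₀ + K + 1)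
                    (epsOfRecord θ.ν (histB₁₃ θ K₀ g₀ K) (K₀ + K + 1) * (1 - ρB K)) s' V *
                  dressedSlotsOfDatum₉ F N θ.toStage9Params (datumOfRecord₁₃CoPH F N θ hP) g₀ os t (runB₁₃ F K₀ g₀ K) (histB₁₃ θ K₀ g₀ K) (K₀ + K + 1) s' V
                  ∂fieldMeasure (F.P (K₀ + K + 1)) (K₀ + K + 1) (Node00.SU N)) ∧
            ∑ s' ∈ Finset.univ.filter (fun s' : SeqOfRecord F θ.ν θ.τ9.M (histB₁₃ θ K₀ g₀ K) (K₀ + K + 1) (K₀ + K + 1) => keyB₁₃ θ K₀ g₀ K s' = keyA₁₃ θ K₀ g₀ K s),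
                  (∫ V, chiSeqOfRecordAt F N θ.ν θ.τ9.M (histB₁₃ θ K₀ g₀ K) (K₀ + K + 1) (K₀ + K + 1)
                    (epsOfRecord θ.ν (histB₁₃ θ K₀ g₀ K) (K₀ + K + 1) * (1 - ρB K)) s' V *
                  dressedSlotsOfDatum₉ F N θ.toStage9Params (datumOfRecord₁₃CoPH F N θ hP) g₀ os t (runB₁₃ F K₀ g₀ K) (histB₁₃ θ K₀ g₀ K) (K₀ + K + 1) s' V
                  ∂fieldMeasure (F.P (K₀ + K + 1)) (K₀ + K + 1) (Node00.SU N))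
              ≤ Real.exp (c + vol * δ K) * (∫ V, chiSeqOfRecordAt F N θ.ν θ.τ9.M (histA₁₃ θ K₀ g₀ K) (K₀ + K) (K₀ + K)
                    (epsOfRecord θ.ν (histA₁₃ θ K₀ g₀ K) (K₀ + K) * (1 - ρA K)) s V *
                  dressedSlotsOfDatum₉ F N θ.toStage9Params (datumOfRecord₁₃CoPH F N θ hP) g₀ os t (runA₁₃ F K₀ g₀ K) (histA₁₃ θ K₀ g₀ K) (K₀ + K) s V
                  ∂fieldMeasure (F.P (K₀ + K)) (K₀ + K) (Node00.SU N))) ∧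
          (∀ s' : SeqOfRecord F θ.ν θ.τ9.M (histB₁₃ θ K₀ g₀ K) (K₀ + K + 1) (K₀ + K + 1), keyB₁₃ θ K₀ g₀ K s' ∉ Finset.univ.image (keyA₁₃ θ K₀ g₀ K) →
            keyB₁₃ θ K₀ g₀ K s' ∉ badClass₁₃ θ K₀ g₀ jcut K t →
            ∑ s'' ∈ Finset.univ.filter (fun s'' : SeqOfRecord F θ.ν θ.τ9.M (histB₁₃ θ K₀ g₀ K) (K₀ + K + 1) (K₀ + K + 1) => keyB₁₃ θ K₀ g₀ K s'' = keyB₁₃ θ K₀ g₀ K s'),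
                (∫ V, chiSeqOfRecordAt F N θ.ν θ.τ9.M (histB₁₃ θ K₀ g₀ K) (K₀ + K + 1) (K₀ + K + 1)
                    (epsOfRecord θ.ν (histB₁₃ θ K₀ g₀ K) (K₀ + K + 1) * (1 - ρB K)) s'' V *
                  dressedSlotsOfDatum₉ F N θ.toStage9Params (datumOfRecord₁₃CoPH F N θ hP) g₀ os t (runB₁₃ F K₀ g₀ K) (histB₁₃ θ K₀ g₀ K) (K₀ + K + 1) s'' V
                  ∂fieldMeasure (F.P (K₀ + K + 1)) (K₀ + K + 1) (Node00.SU N)) = 0)) := by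
  rw [core_shellSplit₁₃_iff_flowFree θ hP K₀ g₀ os jcut ρA ρB l₀ vol δ]
  letI : ∀ Kc, DecidableEq (SiteSeqKey F Kc) := fun _ => Classical.decEq _
  have hlowB : ∀ (K : ℕ) (t : ℝ) (S : Finset (SeqOfRecord F θ.ν θ.τ9.M (histB₁₃ θ K₀ g₀ K) (K₀ + K + 1) (K₀ + K + 1))),
      ∑ s'' ∈ S, (classWeightOfDatum₉ F N θ.toStage9Params (datumOfRecord₁₃CoPH F N θ hP) g₀ os (runB₁₃ F K₀ g₀ K) (histB₁₃ θ K₀ g₀ K) (K₀ + K + 1) t s''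
          - shellWeightOfDatum₉ F N θ.toStage9Params (datumOfRecord₁₃CoPH F N θ hP) g₀ os (runB₁₃ F K₀ g₀ K) (histB₁₃ θ K₀ g₀ K) (K₀ + K + 1) (ρB K) t s'')
        = ∑ s'' ∈ S, (∫ V, chiSeqOfRecordAt F N θ.ν θ.τ9.M (histB₁₃ θ K₀ g₀ K) (K₀ + K + 1) (K₀ + K + 1)
                    (epsOfRecord θ.ν (histB₁₃ θ K₀ g₀ K) (K₀ + K + 1) * (1 - ρB K)) s'' V *
                  dressedSlotsOfDatum₉ F N θ.toStage9Params (datumOfRecord₁₃CoPH F N θ hP) g₀ os t (runB₁₃ F K₀ g₀ K) (histB₁₃ θ K₀ g₀ K) (K₀ + K + 1) s'' V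
                  ∂fieldMeasure (F.P (K₀ + K + 1)) (K₀ + K + 1) (Node00.SU N)) :=
    fun K t S => Finset.sum_congr rfl fun s'' _ =>
      classWeight_sub_shellWeight_eq_lowered F N θ.toStage9Params (datumOfRecord₁₃CoPH F N θ hP) g₀ os (runB₁₃ F K₀ g₀ K) (histB₁₃ θ K₀ g₀ K) (K₀ + K + 1)
        hU (hρB K) t s'' (hintB K t s'')
  refine forall_congr' fun K => exists_congr fun c => forall_congr' fun t => forall_congr' fun _ => and_congr ?_ ?_
  · refine forall_congr' fun s => forall_congr' fun _ => ?_
    rw [classWeight_sub_shellWeight_eq_lowered F N θ.toStage9Params (datumOfRecord₁₃CoPH F N θ hP) g₀ os (runA₁₃ F K₀ g₀ K) (histA₁₃ θ K₀ g₀ K) (K₀ + K)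
        hU (hρA K) t s (hintA K t s), hlowB K t]
    exact Iff.rfl
  · refine forall_congr' fun s' => forall_congr' fun _ => forall_congr' fun _ => ?_
    rw [hlowB K t]

/-- **★★★ ON THE LIVE-SELECTOR LINE, FLOW-FREE: N19′'s CORE EDGE AT `crOfRecord₁₃At K₀ jcut (shellSplitOfRecord₁₃At N K₀ ρA ρB)`** from the lowered FLOW-FREE pair
«(i) two-sided sandwich over the flow-free fibre, (ii) one-sided run-B classes carry zero fibre core» + `Summable δ` + (H-U) + (H-ζ) + the widths' sign — NO `RAgree`,
NO `0 < θ.τ9.M`, EVERY policy.  (F3's (e1) integrability: dag-n21-d's `integrable_topPieceA∕B_of_liveSel`; `0 ≤ ζ`: n20-w2; sign letter: module 7.)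
[cite: King1986, (3.10) p.656; Balaban1989LargeFieldII, Thm 1 + (0.1) pp.355–356, (1.80) p.384; Balaban1988Convergent, (2.5) p.255, (2.17)–(2.18) p.257; Balaban1989LargeFieldI, (0.3) p.176, p.193 (bookkeeping)] -/
theorem core_crOfRecord₁₃At_shellSplit_of_loweredFlowFree_liveSel (jcut : ℕ → ℕ) (ρA ρB : WidthLetter₁₃CoPH N) {δ : ℕ → ℝ} (hδ : Summable δ)
    (E : B12.RunParams → ℝ) (hsel : θ.ppSel = ppSelLiveOfRecord F N θ.ν θ.τ9 E (wOfRecord₉ F N θ.toStage9Params))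
    (hU : LocalBgMeasurable F N θ.ν) (hζm : ZetaMeasurable F N θ.ζ)
    (hρA : ∀ K, 0 ≤ epsOfRecord θ.ν (histA₁₃ θ K₀ g₀ K) (K₀ + K) * ρA F θ hP g₀ os K)
    (hρB : ∀ K, 0 ≤ epsOfRecord θ.ν (histB₁₃ θ K₀ g₀ K) (K₀ + K + 1) * ρB F θ hP g₀ os K)
    (hflow : letI : ∀ Kc, DecidableEq (SiteSeqKey F Kc) := fun _ => Classical.decEq _
      ∀ K : ℕ, ∃ c : ℝ, ∀ t : ℝ, |t| ≤ 1 →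
          (∀ s : SeqOfRecord F θ.ν θ.τ9.M (histA₁₃ θ K₀ g₀ K) (K₀ + K) (K₀ + K), keyA₁₃ θ K₀ g₀ K s ∉ badClass₁₃ θ K₀ g₀ jcut K t →
            Real.exp (c - 1 * δ K) * (∫ V, chiSeqOfRecordAt F N θ.ν θ.τ9.M (histA₁₃ θ K₀ g₀ K) (K₀ + K) (K₀ + K)
                    (epsOfRecord θ.ν (histA₁₃ θ K₀ g₀ K) (K₀ + K) * (1 - ρA F θ hP g₀ os K)) s V *
                  dressedSlotsOfDatum₉ F N θ.toStage9Params (datumOfRecord₁₃CoPH F N θ hP) g₀ os t (runA₁₃ F K₀ g₀ K) (histA₁₃ θ K₀ g₀ K) (K₀ + K) s V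
                  ∂fieldMeasure (F.P (K₀ + K)) (K₀ + K) (Node00.SU N))
              ≤ ∑ s' ∈ Finset.univ.filter (fun s' : SeqOfRecord F θ.ν θ.τ9.M (histB₁₃ θ K₀ g₀ K) (K₀ + K + 1) (K₀ + K + 1) => keyB₁₃ θ K₀ g₀ K s' = keyA₁₃ θ K₀ g₀ K s),
                  (∫ V, chiSeqOfRecordAt F N θ.ν θ.τ9.M (histB₁₃ θ K₀ g₀ K) (K₀ + K + 1) (K₀ + K + 1)
                    (epsOfRecord θ.ν (histB₁₃ θ K₀ g₀ K) (K₀ + K + 1) * (1 - ρB F θ hP g₀ os K)) s' V *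
                  dressedSlotsOfDatum₉ F N θ.toStage9Params (datumOfRecord₁₃CoPH F N θ hP) g₀ os t (runB₁₃ F K₀ g₀ K) (histB₁₃ θ K₀ g₀ K) (K₀ + K + 1) s' V
                  ∂fieldMeasure (F.P (K₀ + K + 1)) (K₀ + K + 1) (Node00.SU N)) ∧
            ∑ s' ∈ Finset.univ.filter (fun s' : SeqOfRecord F θ.ν θ.τ9.M (histB₁₃ θ K₀ g₀ K) (K₀ + K + 1) (K₀ + K + 1) => keyB₁₃ θ K₀ g₀ K s' = keyA₁₃ θ K₀ g₀ K s),
                  (∫ V, chiSeqOfRecordAt F N θ.ν θ.τ9.M (histB₁₃ θ K₀ g₀ K) (K₀ + K + 1) (K₀ + K + 1)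
                    (epsOfRecord θ.ν (histB₁₃ θ K₀ g₀ K) (K₀ + K + 1) * (1 - ρB F θ hP g₀ os K)) s' V *
                  dressedSlotsOfDatum₉ F N θ.toStage9Params (datumOfRecord₁₃CoPH F N θ hP) g₀ os t (runB₁₃ F K₀ g₀ K) (histB₁₃ θ K₀ g₀ K) (K₀ + K + 1) s' V
                  ∂fieldMeasure (F.P (K₀ + K + 1)) (K₀ + K + 1) (Node00.SU N))
              ≤ Real.exp (c + 1 * δ K) * (∫ V, chiSeqOfRecordAt F N θ.ν θ.τ9.M (histA₁₃ θ K₀ g₀ K) (K₀ + K) (K₀ + K)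
                    (epsOfRecord θ.ν (histA₁₃ θ K₀ g₀ K) (K₀ + K) * (1 - ρA F θ hP g₀ os K)) s V *
                  dressedSlotsOfDatum₉ F N θ.toStage9Params (datumOfRecord₁₃CoPH F N θ hP) g₀ os t (runA₁₃ F K₀ g₀ K) (histA₁₃ θ K₀ g₀ K) (K₀ + K) s V
                  ∂fieldMeasure (F.P (K₀ + K)) (K₀ + K) (Node00.SU N))) ∧
          (∀ s' : SeqOfRecord F θ.ν θ.τ9.M (histB₁₃ θ K₀ g₀ K) (K₀ + K + 1) (K₀ + K + 1), keyB₁₃ θ K₀ g₀ K s' ∉ Finset.univ.image (keyA₁₃ θ K₀ g₀ K) →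
            keyB₁₃ θ K₀ g₀ K s' ∉ badClass₁₃ θ K₀ g₀ jcut K t →
            ∑ s'' ∈ Finset.univ.filter (fun s'' : SeqOfRecord F θ.ν θ.τ9.M (histB₁₃ θ K₀ g₀ K) (K₀ + K + 1) (K₀ + K + 1) => keyB₁₃ θ K₀ g₀ K s'' = keyB₁₃ θ K₀ g₀ K s'),
                (∫ V, chiSeqOfRecordAt F N θ.ν θ.τ9.M (histB₁₃ θ K₀ g₀ K) (K₀ + K + 1) (K₀ + K + 1)
                    (epsOfRecord θ.ν (histB₁₃ θ K₀ g₀ K) (K₀ + K + 1) * (1 - ρB F θ hP g₀ os K)) s'' V *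
                  dressedSlotsOfDatum₉ F N θ.toStage9Params (datumOfRecord₁₃CoPH F N θ hP) g₀ os t (runB₁₃ F K₀ g₀ K) (histB₁₃ θ K₀ g₀ K) (K₀ + K + 1) s'' V
                  ∂fieldMeasure (F.P (K₀ + K + 1)) (K₀ + K + 1) (Node00.SU N)) = 0)) :
    (letI := (crOfRecord₁₃At K₀ jcut (shellSplitOfRecord₁₃At N K₀ ρA ρB) F θ hP g₀ os).dec
     NE7.Core (crOfRecord₁₃At K₀ jcut (shellSplitOfRecord₁₃At N K₀ ρA ρB) F θ hP g₀ os).l₀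
      (crOfRecord₁₃At K₀ jcut (shellSplitOfRecord₁₃At N K₀ ρA ρB) F θ hP g₀ os).vol (crOfRecord₁₃At K₀ jcut (shellSplitOfRecord₁₃At N K₀ ρA ρB) F θ hP g₀ os).T
      (crOfRecord₁₃At K₀ jcut (shellSplitOfRecord₁₃At N K₀ ρA ρB) F θ hP g₀ os).Bad
      (fun K t τ => (crOfRecord₁₃At K₀ jcut (shellSplitOfRecord₁₃At N K₀ ρA ρB) F θ hP g₀ os).A K t τ
        - (crOfRecord₁₃At K₀ jcut (shellSplitOfRecord₁₃At N K₀ ρA ρB) F θ hP g₀ os).shA K t τ)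
      (fun K t τ => (crOfRecord₁₃At K₀ jcut (shellSplitOfRecord₁₃At N K₀ ρA ρB) F θ hP g₀ os).B K t τ
        - (crOfRecord₁₃At K₀ jcut (shellSplitOfRecord₁₃At N K₀ ρA ρB) F θ hP g₀ os).shB K t τ)
      (crOfRecord₁₃At K₀ jcut (shellSplitOfRecord₁₃At N K₀ ρA ρB) F θ hP g₀ os).δ) ∧
      Summable (crOfRecord₁₃At K₀ jcut (shellSplitOfRecord₁₃At N K₀ ρA ρB) F θ hP g₀ os).δ :=
  YMDAG.UVSplit.core_crOfRecord₁₃At K₀ jcut (shellSplitOfRecord₁₃At N K₀ ρA ρB) θ hP g₀ os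
    (fun K t _ x _ => weightA₁₃_sub_shellA₁₃_nonneg θ hP K₀ g₀ os (ρA F θ hP g₀ os)
      (integrable_topPieceA_of_liveSel K₀ θ hP E hsel hU hζm (N21KeyedShellWeightShellZero.zeta_nonneg_of_provisos₁₃CoPH F θ hP) g₀ os) K t x)
    ((core_shellSplit₁₃_iff_loweredFlowFree θ hP K₀ g₀ os jcut (ρA F θ hP g₀ os) (ρB F θ hP g₀ os) 1 1 δ hU hρA hρB
      (integrable_topPieceA_of_liveSel K₀ θ hP E hsel hU hζm (N21KeyedShellWeightShellZero.zeta_nonneg_of_provisos₁₃CoPH F θ hP) g₀ os)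
      (integrable_topPieceB_of_liveSel K₀ θ hP E hsel hU hζm (N21KeyedShellWeightShellZero.zeta_nonneg_of_provisos₁₃CoPH F θ hP) g₀ os)).2 hflow) hδ

/-- **★★★ ON THE LIVE-SELECTOR LINE, FLOW-FREE: N19′'s CORE EDGE AT `crOfRecord₁₃VAt K₀ jcut (shellSplitOfRecord₁₃At N K₀ ρA ρB)`** from the lowered FLOW-FREE pair
«(i) two-sided sandwich over the flow-free fibre, (ii) one-sided run-B classes carry zero fibre core» + `Summable δ` + (H-U) + (H-ζ) + the widths' sign — NO `RAgree`,
NO `0 < θ.τ9.M`, EVERY policy.  (F3's (e1) integrability: dag-n21-d's `integrable_topPieceA∕B_of_liveSel`; `0 ≤ ζ`: n20-w2; sign letter: module 7.)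
[cite: King1986, (3.10) p.656; Balaban1989LargeFieldII, Thm 1 + (0.1) pp.355–356, (1.80) p.384; Balaban1988Convergent, (2.5) p.255, (2.17)–(2.18) p.257; Balaban1989LargeFieldI, (0.3) p.176, p.193 (bookkeeping)] -/
theorem core_crOfRecord₁₃VAt_shellSplit_of_loweredFlowFree_liveSel (jcut : ℕ → ℕ) (ρA ρB : WidthLetter₁₃CoPH N) {δ : ℕ → ℝ} (hδ : Summable δ)
    (E : B12.RunParams → ℝ) (hsel : θ.ppSel = ppSelLiveOfRecord F N θ.ν θ.τ9 E (wOfRecord₉ F N θ.toStage9Params))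
    (hU : LocalBgMeasurable F N θ.ν) (hζm : ZetaMeasurable F N θ.ζ)
    (hρA : ∀ K, 0 ≤ epsOfRecord θ.ν (histA₁₃ θ K₀ g₀ K) (K₀ + K) * ρA F θ hP g₀ os K)
    (hρB : ∀ K, 0 ≤ epsOfRecord θ.ν (histB₁₃ θ K₀ g₀ K) (K₀ + K + 1) * ρB F θ hP g₀ os K)
    (hflow : letI : ∀ Kc, DecidableEq (SiteSeqKey F Kc) := fun _ => Classical.decEq _
      ∀ K : ℕ, ∃ c : ℝ, ∀ t : ℝ, |t| ≤ 1 →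
          (∀ s : SeqOfRecord F θ.ν θ.τ9.M (histA₁₃ θ K₀ g₀ K) (K₀ + K) (K₀ + K), keyA₁₃ θ K₀ g₀ K s ∉ badClass₁₃ θ K₀ g₀ jcut K t →
            Real.exp (c - F.side ^ 4 * δ K) * (∫ V, chiSeqOfRecordAt F N θ.ν θ.τ9.M (histA₁₃ θ K₀ g₀ K) (K₀ + K) (K₀ + K)
                    (epsOfRecord θ.ν (histA₁₃ θ K₀ g₀ K) (K₀ + K) * (1 - ρA F θ hP g₀ os K)) s V *
                  dressedSlotsOfDatum₉ F N θ.toStage9Params (datumOfRecord₁₃CoPH F N θ hP) g₀ os t (runA₁₃ F K₀ g₀ K) (histA₁₃ θ K₀ g₀ K) (K₀ + K) s V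
                  ∂fieldMeasure (F.P (K₀ + K)) (K₀ + K) (Node00.SU N))
              ≤ ∑ s' ∈ Finset.univ.filter (fun s' : SeqOfRecord F θ.ν θ.τ9.M (histB₁₃ θ K₀ g₀ K) (K₀ + K + 1) (K₀ + K + 1) => keyB₁₃ θ K₀ g₀ K s' = keyA₁₃ θ K₀ g₀ K s),
                  (∫ V, chiSeqOfRecordAt F N θ.ν θ.τ9.M (histB₁₃ θ K₀ g₀ K) (K₀ + K + 1) (K₀ + K + 1)
                    (epsOfRecord θ.ν (histB₁₃ θ K₀ g₀ K) (K₀ + K + 1) * (1 - ρB F θ hP g₀ os K)) s' V *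
                  dressedSlotsOfDatum₉ F N θ.toStage9Params (datumOfRecord₁₃CoPH F N θ hP) g₀ os t (runB₁₃ F K₀ g₀ K) (histB₁₃ θ K₀ g₀ K) (K₀ + K + 1) s' V
                  ∂fieldMeasure (F.P (K₀ + K + 1)) (K₀ + K + 1) (Node00.SU N)) ∧
            ∑ s' ∈ Finset.univ.filter (fun s' : SeqOfRecord F θ.ν θ.τ9.M (histB₁₃ θ K₀ g₀ K) (K₀ + K + 1) (K₀ + K + 1) => keyB₁₃ θ K₀ g₀ K s' = keyA₁₃ θ K₀ g₀ K s),
                  (∫ V, chiSeqOfRecordAt F N θ.ν θ.τ9.M (histB₁₃ θ K₀ g₀ K) (K₀ + K + 1) (K₀ + K + 1)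
                    (epsOfRecord θ.ν (histB₁₃ θ K₀ g₀ K) (K₀ + K + 1) * (1 - ρB F θ hP g₀ os K)) s' V *
                  dressedSlotsOfDatum₉ F N θ.toStage9Params (datumOfRecord₁₃CoPH F N θ hP) g₀ os t (runB₁₃ F K₀ g₀ K) (histB₁₃ θ K₀ g₀ K) (K₀ + K + 1) s' V
                  ∂fieldMeasure (F.P (K₀ + K + 1)) (K₀ + K + 1) (Node00.SU N))
              ≤ Real.exp (c + F.side ^ 4 * δ K) * (∫ V, chiSeqOfRecordAt F N θ.ν θ.τ9.M (histA₁₃ θ K₀ g₀ K) (K₀ + K) (K₀ + K)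
                    (epsOfRecord θ.ν (histA₁₃ θ K₀ g₀ K) (K₀ + K) * (1 - ρA F θ hP g₀ os K)) s V *
                  dressedSlotsOfDatum₉ F N θ.toStage9Params (datumOfRecord₁₃CoPH F N θ hP) g₀ os t (runA₁₃ F K₀ g₀ K) (histA₁₃ θ K₀ g₀ K) (K₀ + K) s V
                  ∂fieldMeasure (F.P (K₀ + K)) (K₀ + K) (Node00.SU N))) ∧
          (∀ s' : SeqOfRecord F θ.ν θ.τ9.M (histB₁₃ θ K₀ g₀ K) (K₀ + K + 1) (K₀ + K + 1), keyB₁₃ θ K₀ g₀ K s' ∉ Finset.univ.image (keyA₁₃ θ K₀ g₀ K) →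
            keyB₁₃ θ K₀ g₀ K s' ∉ badClass₁₃ θ K₀ g₀ jcut K t →
            ∑ s'' ∈ Finset.univ.filter (fun s'' : SeqOfRecord F θ.ν θ.τ9.M (histB₁₃ θ K₀ g₀ K) (K₀ + K + 1) (K₀ + K + 1) => keyB₁₃ θ K₀ g₀ K s'' = keyB₁₃ θ K₀ g₀ K s'),
                (∫ V, chiSeqOfRecordAt F N θ.ν θ.τ9.M (histB₁₃ θ K₀ g₀ K) (K₀ + K + 1) (K₀ + K + 1)
                    (epsOfRecord θ.ν (histB₁₃ θ K₀ g₀ K) (K₀ + K + 1) * (1 - ρB F θ hP g₀ os K)) s'' V *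
                  dressedSlotsOfDatum₉ F N θ.toStage9Params (datumOfRecord₁₃CoPH F N θ hP) g₀ os t (runB₁₃ F K₀ g₀ K) (histB₁₃ θ K₀ g₀ K) (K₀ + K + 1) s'' V
                  ∂fieldMeasure (F.P (K₀ + K + 1)) (K₀ + K + 1) (Node00.SU N)) = 0)) :
    (letI := (crOfRecord₁₃VAt K₀ jcut (shellSplitOfRecord₁₃At N K₀ ρA ρB) F θ hP g₀ os).dec
     NE7.Core (crOfRecord₁₃VAt K₀ jcut (shellSplitOfRecord₁₃At N K₀ ρA ρB) F θ hP g₀ os).l₀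
      (crOfRecord₁₃VAt K₀ jcut (shellSplitOfRecord₁₃At N K₀ ρA ρB) F θ hP g₀ os).vol (crOfRecord₁₃VAt K₀ jcut (shellSplitOfRecord₁₃At N K₀ ρA ρB) F θ hP g₀ os).T
      (crOfRecord₁₃VAt K₀ jcut (shellSplitOfRecord₁₃At N K₀ ρA ρB) F θ hP g₀ os).Bad
      (fun K t τ => (crOfRecord₁₃VAt K₀ jcut (shellSplitOfRecord₁₃At N K₀ ρA ρB) F θ hP g₀ os).A K t τ
        - (crOfRecord₁₃VAt K₀ jcut (shellSplitOfRecord₁₃At N K₀ ρA ρB) F θ hP g₀ os).shA K t τ)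
      (fun K t τ => (crOfRecord₁₃VAt K₀ jcut (shellSplitOfRecord₁₃At N K₀ ρA ρB) F θ hP g₀ os).B K t τ
        - (crOfRecord₁₃VAt K₀ jcut (shellSplitOfRecord₁₃At N K₀ ρA ρB) F θ hP g₀ os).shB K t τ)
      (crOfRecord₁₃VAt K₀ jcut (shellSplitOfRecord₁₃At N K₀ ρA ρB) F θ hP g₀ os).δ) ∧
      Summable (crOfRecord₁₃VAt K₀ jcut (shellSplitOfRecord₁₃At N K₀ ρA ρB) F θ hP g₀ os).δ :=
  YMDAG.UVSplit.core_crOfRecord₁₃VAt K₀ jcut (shellSplitOfRecord₁₃At N K₀ ρA ρB) θ hP g₀ os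
    (fun K t _ x _ => weightA₁₃_sub_shellA₁₃_nonneg θ hP K₀ g₀ os (ρA F θ hP g₀ os)
      (integrable_topPieceA_of_liveSel K₀ θ hP E hsel hU hζm (N21KeyedShellWeightShellZero.zeta_nonneg_of_provisos₁₃CoPH F θ hP) g₀ os) K t x)
    ((core_shellSplit₁₃_iff_loweredFlowFree θ hP K₀ g₀ os jcut (ρA F θ hP g₀ os) (ρB F θ hP g₀ os) 1 (F.side ^ 4) δ hU hρA hρB
      (integrable_topPieceA_of_liveSel K₀ θ hP E hsel hU hζm (N21KeyedShellWeightShellZero.zeta_nonneg_of_provisos₁₃CoPH F θ hP) g₀ os)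
      (integrable_topPieceB_of_liveSel K₀ θ hP E hsel hU hζm (N21KeyedShellWeightShellZero.zeta_nonneg_of_provisos₁₃CoPH F θ hP) g₀ os)).2 hflow) hδ

end Lowered

end Summit.QuantumFields.YangMills.BalabanUVNodes.N20CoreEdgeAtShellSplitFlowFree

end
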